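import Summits.ValiantsHypothesis.ValiantsHypothesis.Theorems.KPlusLogSqLawTropicalBPadding
import Summits.ValiantsHypothesis.ValiantsHypothesis.Theorems.KPlusLogSqLawTropicalBStaircaseDesign

/-!
# Route «KPlusLogSqLaw», crux `TropicalB` (stmt-ValiantsHypothesis-19771) — CALIBRATION OF THE DIAGONAL: the formats
# `(2^s, s²)` carry `2^(Ω(s²))` sign-alternating dominant breakpoints

HONEST FRAMING.  Helper file for the registered stubs `stub_tropThin` / `stub_tropFat` of `Cruxes/TropicalB/Lines/birth.lean`
(crux `TropicalB`, DRAFT route `KPlusLogSqLaw`, cell `pub-symmetroid`, seat val-sym-trop-p4 (g2), 2026-08-26).  It proves NO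
part of either stub.  The companion file `…TropicalBRegimeCollapse` shows that the crux is the one-parameter DIAGONAL law
`∃ C, ∀ s, TropRootLawAt (2^s) (s^2) (2^(C·s^2))` (`tropicalB_iff_diagonal`).  This file records that the exponent `s²`
of that law is the right scale FROM BELOW, unconditionally: the tree's STAIRCASE family (seat val-sym-trop-p1,
`WalkDesign.staircase_lower`: `n^L − 1` breakpoints with `L + 1` classes on `((2^L − 1)(n+1)+1)·(2^(L+1) n) ≤ 2^(2L+2) n²`
nodes), run with `n = 2^t`, `L = t`, sits inside the diagonal format `(2^(4t+2), (4t+2)²)` by format monotonicity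
(`tropRootLawAt_of_le`, seat val-sym-trop-p1), so

* `staircase_diagonal`  — `TropRootLawAt (2^(4t+2)) (t+1) B → 2^(t·t) − 1 ≤ B` (`t ≥ 1`);
* `diagonal_lower`      — `TropRootLawAt (2^s) (s^2) B → 2^(⌊(s−2)/4⌋·⌊(s−2)/4⌋) − 1 ≤ B` (`s ≥ 6`);
* `diagonal_lower_div`  — `TropRootLawAt (2^s) (s^2) B → 2^(s²/17) ≤ B` (`s ≥ 166`).

READING.  `log₂ T(2^s, s²) ≥ s²/17` for all large `s` (with only `⌊(s−2)/4⌋ + 1 ≪ s²` of the available classes used), while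
`TropicalB` is the assertion `log₂ T(2^s, s²) ≤ C·s²`: on the diagonal the crux asks exactly whether the staircase exponent
is optimal up to the constant — the remaining `s² − s/4` slope classes must buy at most a constant factor in the exponent.
Nothing here bears on `TropicalB` itself, `Lifting`, `MatrixDescartes` (stmt-ValiantsHypothesis-18050) or VP ≠ VNP.
[folklore] parameter bookkeeping over the tree's staircase theorem (Carstensen 1983 / Mulmuley–Shah 2001 type family).
-/

set_option linter.dupNamespace false
set_option autoImplicit false

namespace Summit.ValiantsHypothesis.ValiantsHypothesis.Theorems.KPlusLogSqLaw

open Summit.ValiantsHypothesis.ValiantsHypothesis.Theorems.LacunarySymmetroidMatrixDescartes.TropicalCensus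
open Summit.ValiantsHypothesis.ValiantsHypothesis.Theorems.KPlusLogSqLaw.WalkDesign (staircase_lower staircase_format_le)

/-- **The staircase inside a diagonal format.**  With `n = 2^t` and `L = t` (`t ≥ 1`) the staircase has `t + 1` classes,
at most `2^(2t+2)·2^(2t) = 2^(4t+2)` nodes and `2^(t·t) − 1` breakpoints: `TropRootLawAt (2^(4t+2)) (t+1) B → 2^(t·t) − 1 ≤ B`. -/
theorem staircase_diagonal (t : ℕ) (ht : 1 ≤ t) (B : ℕ) (h : TropRootLawAt (2 ^ (4 * t + 2)) (t + 1) B) :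
    2 ^ (t * t) - 1 ≤ B := by
  have hn2 : 2 ≤ 2 ^ t := by
    calc 2 = 2 ^ 1 := by norm_num
      _ ≤ 2 ^ t := Nat.pow_le_pow_right two_pos ht
  have hne : Even (2 ^ t) := by
    obtain ⟨u, rfl⟩ := Nat.exists_eq_add_of_le ht
    exact ⟨2 ^ u, by ring⟩
  have hsize : ((2 ^ t - 1) * (2 ^ t + 1) + 1) * (2 ^ t * 2 ^ t * 2) ≤ 2 ^ (4 * t + 2) := by
    calc ((2 ^ t - 1) * (2 ^ t + 1) + 1) * (2 ^ t * 2 ^ t * 2) ≤ 2 ^ (2 * t + 2) * (2 ^ t) ^ 2 :=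
          staircase_format_le (2 ^ t) t (by omega)
      _ = 2 ^ (4 * t + 2) := by rw [← pow_mul, ← pow_add]; ring_nf
  have h1 : TropRootLawAt (((2 ^ t - 1) * (2 ^ t + 1) + 1) * (2 ^ t * 2 ^ t * 2)) (t + 1) B :=
    tropRootLawAt_of_le hsize le_rfl h
  have h2 := staircase_lower (2 ^ t) t hn2 hne ht B h1
  rwa [← pow_mul] at h2

/-- **Diagonal lower bound.**  For `s ≥ 6`, with `t = ⌊(s − 2)/4⌋ ≥ 1` (so `4t + 2 ≤ s`, `t + 1 ≤ s²`):
`TropRootLawAt (2^s) (s^2) B → 2^(t·t) − 1 ≤ B`. -/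
theorem diagonal_lower (s : ℕ) (hs : 6 ≤ s) (B : ℕ) (h : TropRootLawAt (2 ^ s) (s ^ 2) B) :
    2 ^ (((s - 2) / 4) * ((s - 2) / 4)) - 1 ≤ B := by
  set t := (s - 2) / 4 with ht
  have ht1 : 1 ≤ t := by omega
  have h4t : 4 * t + 2 ≤ s := by omega
  have hcl : t + 1 ≤ s ^ 2 := by nlinarith
  exact staircase_diagonal t ht1 B
    (tropRootLawAt_of_le (Nat.pow_le_pow_right two_pos h4t) hcl h)

/-- **Diagonal lower bound, exponent form.**  For `s ≥ 166`: `TropRootLawAt (2^s) (s^2) B → 2^(s²/17) ≤ B`, i.e.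
`log₂ T(2^s, s²) ≥ ⌊s²/17⌋` (`s ≤ 4t + 5` gives `s² ≤ 16t² + 40t + 25 < 17 t²` once `t ≥ 41`). -/
theorem diagonal_lower_div (s : ℕ) (hs : 166 ≤ s) (B : ℕ) (h : TropRootLawAt (2 ^ s) (s ^ 2) B) :
    2 ^ (s ^ 2 / 17) ≤ B := by
  have h1 := diagonal_lower s (by omega) B h
  set t := (s - 2) / 4 with ht
  have ht41 : 41 ≤ t := by omega
  have hs5 : s ≤ 4 * t + 5 := by omega
  have hlt : s ^ 2 / 17 < t * t := by
    have h2 : s ^ 2 ≤ (4 * t + 5) ^ 2 := Nat.pow_le_pow_left hs5 2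
    have h3 : (4 * t + 5) ^ 2 < 17 * (t * t) := by nlinarith
    exact Nat.div_lt_of_lt_mul (by linarith)
  have h4 : 2 ^ (s ^ 2 / 17) < 2 ^ (t * t) := Nat.pow_lt_pow_right (by norm_num) hlt
  omega

end Summit.ValiantsHypothesis.ValiantsHypothesis.Theorems.KPlusLogSqLaw
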